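import Summits.ValiantsHypothesis.ValiantsHypothesis.Theorems.KPlusLogSqLawTridiagonalRealStaticUnitRows
import Summits.ValiantsHypothesis.ValiantsHypothesis.Theorems.KPlusLogSqLawTridiagonalRealStaticUnitEntropyBalance

/-!
# Route «KPlusLogSqLaw», crux `WeakLifting` (stmt-ValiantsHypothesis-19561) — REAL side of the tridiagonal sector:
# the UNIT-COEFFICIENT sub-sector, ALL SIZES — the CROSSING-DIRECTION LAW (slope-weighted pivot energy at a determinant zero)

HONEST FRAMING.  Helper theorems (`--supports stmt-ValiantsHypothesis-19561 --as helper`), seat val-sym-lift-p1 (g18), cell `pub-symmetroid`,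
2026-08-28.  Currency `StaticTridiagonalRealPotential.pathDet (fun _ => 1) d (fun _ => 1) f` (continuants `D_k(x)`, `D_{k+2} = x^{d_{k+1}}D_{k+1} −
x^{2f_k}D_k`), edge slopes `L_k = 2f_k − d_k − d_{k+1}`, `F_k = f_0 + ⋯ + f_{k−1}`.  At a positive zero `x` of `D_m` with `D_1, …, D_{m−1}` nonzero
the monomial matrix has the kernel vector `w_i = (−1)^i D_i(x) x^{−F_i}`; its EDGE ENERGIES `e_k := D_k D_{k+1} x^{−2F_k}` (sign = sign of the
`k`-th pivot) and VERTEX MASSES `μ_i := x^{d_i} D_i² x^{−2F_i}` obey `μ_0 = e_0`, `μ_{i+1} = e_i + e_{i+1}` (the recurrence), `μ_{m−1} = e_{m−2}`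
(the zero) and `μ_kμ_{k+1}/e_k² = x^{−L_k}` (`energy_zero`, `energy_succ_add`, `ratio_eq`, `log_ratio`).  The quadratic form of the entrywise
`x·d/dx` of the matrix at `w` is `−Σ_k L_k e_k` (memo CROSSING-DIRECTION-liftp1g18.md §1: this sign decides whether the zero eigenvalue moves
down — one more negative eigenvalue — or up as `x` increases; by Jacobi's formula `x·D_m'(x)·D_{m−1}(x)` has the sign of `−Σ_k L_k e_k`).
Proved here (all `m ≥ 3`, all exponents):
* **CROSSING-DIRECTION LAW** (`slopeEnergy_balance_pos`): if every edge is RECESSIVE at `x` (`x^{2f_k} < x^{d_k+d_{k+1}}`) and no two negative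
  pivot products `D_kD_{k+1} < 0`, `D_{k+3}D_{k+4} < 0` are exactly three edges apart, then `Σ_k (d_k + d_{k+1} − 2f_k)·log x · e_k > 0`
  — the edge sum equals the vertex entropy balance of `…UnitEntropyBalance` (`edge_sum_eq_vertex_sum`), whose hypotheses follow from
  recessiveness (`flank_aux`: a recessive edge next to an energy `−c` forces the second neighbour's energy above `c`);
* the two sides (`slopeEnergy_pos_below_one`: `x < 1`, all slopes positive ⇒ `Σ_k L_k e_k > 0`; `slopeEnergy_neg_above_one`: `x > 1`, all slopes
  negative ⇒ `Σ_k L_k e_k < 0`): on the recessive side of a one-signed unit design every such zero is crossed TOWARDS MORE NEGATIVE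
  EIGENVALUES; in particular (`…_of_atMostOne…`) every zero at which at most one pivot is negative (the matrix has ≤ 1 negative eigenvalue).
LOCATED / SHARPNESS (memo §3, 60-digit check): the separation hypothesis cannot be dropped — an admissible recessive chain with pivot pattern
`A N J A N J A` (`m = 9`, slope ratios ≈ 10¹⁴; ≈ 7·10³ suffice) has NEGATIVE balance, so «one-signed slopes ⇒ monotone inertia» is false in
general although it holds in every censused box (exact Sturm, `m ≤ 9`, `L ≤ 20`: zeros in `(0,1)` = `⌊m/3⌋` always); on the DOMINANT side the
balance already fails at `m = 7`.  Nothing here is an upper law for the register (α NO MOVER); nothing bears on `WeakLifting` / `TropicalB`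
(stmt-19771) in their windows, Conjecture B, the Door-A registers, `MatrixDescartes` (stmt-18050) or VP ≠ VNP.
[this seat; folklore: continuants / LDLᵀ pivots, kernel vector of a Jacobi matrix, Hellmann–Feynman]
-/

-- `Summit.ValiantsHypothesis.ValiantsHypothesis.…` repeats a component by the D-0017 layout (single-conjunct summit); the name is mandated.
set_option linter.dupNamespace false
set_option autoImplicit false

namespace Summit.ValiantsHypothesis.ValiantsHypothesis.Theorems.KPlusLogSqLaw
namespace StaticTridiagonalRealUnit

open Real Finset Polynomial
open Summit.ValiantsHypothesis.ValiantsHypothesis.Theorems.KPlusLogSqLaw.StaticTridiagonalRealPotential (pathDet)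

variable (d : ℕ → ℕ) (f : ℕ → ℕ)

/-! ### 1. Energies and masses along the continuant chain -/

/-- `μ_0 = e_0`: at vertex `0` the mass `x^{d_0}D_0²` equals the energy `D_0D_1` (`D_0 = 1`, `D_1 = x^{d_0}`). [this file] -/
theorem energy_zero (x : ℝ) :
    x ^ d 0 * (pathDet (fun _ => (1 : ℝ)) d (fun _ => (1 : ℝ)) f 0).eval x ^ 2 / x ^ (2 * ∑ j ∈ range 0, f j) =
      (pathDet (fun _ => (1 : ℝ)) d (fun _ => (1 : ℝ)) f 0).eval x * (pathDet (fun _ => (1 : ℝ)) d (fun _ => (1 : ℝ)) f 1).eval x /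
        x ^ (2 * ∑ j ∈ range 0, f j) := by
  obtain ⟨e0, e1⟩ := eval_unit_zero_one d f x
  rw [e0, e1]; simp

/-- `μ_{i+1} = e_i + e_{i+1}`: the unit recurrence `D_{i+2} = x^{d_{i+1}}D_{i+1} − x^{2f_i}D_i` in energy form. [this file] -/
theorem energy_succ_add (x : ℝ) (hx : 0 < x) (i : ℕ) :
    (pathDet (fun _ => (1 : ℝ)) d (fun _ => (1 : ℝ)) f i).eval x * (pathDet (fun _ => (1 : ℝ)) d (fun _ => (1 : ℝ)) f (i + 1)).eval x /
        x ^ (2 * ∑ j ∈ range i, f j) +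
      (pathDet (fun _ => (1 : ℝ)) d (fun _ => (1 : ℝ)) f (i + 1)).eval x * (pathDet (fun _ => (1 : ℝ)) d (fun _ => (1 : ℝ)) f (i + 2)).eval x /
        x ^ (2 * ∑ j ∈ range (i + 1), f j) =
      x ^ d (i + 1) * (pathDet (fun _ => (1 : ℝ)) d (fun _ => (1 : ℝ)) f (i + 1)).eval x ^ 2 / x ^ (2 * ∑ j ∈ range (i + 1), f j) := by
  rw [eval_unit_add_two d f x i, sum_range_succ, mul_add, pow_add]
  have h1 : x ^ (2 * ∑ j ∈ range i, f j) ≠ 0 := pow_ne_zero _ hx.ne'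
  have h2 : x ^ (2 * f i) ≠ 0 := pow_ne_zero _ hx.ne'
  field_simp
  ring

/-- `μ_k μ_{k+1} / e_k² = x^{d_k + d_{k+1}} / x^{2f_k}` (the edge weight `x^{L_k}` inverted). [this file] -/
theorem ratio_eq (x : ℝ) (hx : 0 < x) (k : ℕ) (hk : (pathDet (fun _ => (1 : ℝ)) d (fun _ => (1 : ℝ)) f k).eval x ≠ 0)
    (hk1 : (pathDet (fun _ => (1 : ℝ)) d (fun _ => (1 : ℝ)) f (k + 1)).eval x ≠ 0) :
    (x ^ d k * (pathDet (fun _ => (1 : ℝ)) d (fun _ => (1 : ℝ)) f k).eval x ^ 2 / x ^ (2 * ∑ j ∈ range k, f j)) *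
        (x ^ d (k + 1) * (pathDet (fun _ => (1 : ℝ)) d (fun _ => (1 : ℝ)) f (k + 1)).eval x ^ 2 / x ^ (2 * ∑ j ∈ range (k + 1), f j)) /
        ((pathDet (fun _ => (1 : ℝ)) d (fun _ => (1 : ℝ)) f k).eval x * (pathDet (fun _ => (1 : ℝ)) d (fun _ => (1 : ℝ)) f (k + 1)).eval x /
          x ^ (2 * ∑ j ∈ range k, f j)) ^ 2 =
      x ^ (d k + d (k + 1)) / x ^ (2 * f k) := by
  rw [sum_range_succ, mul_add, pow_add, pow_add]
  have h1 : x ^ (2 * ∑ j ∈ range k, f j) ≠ 0 := pow_ne_zero _ hx.ne'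
  have h2 : x ^ (2 * f k) ≠ 0 := pow_ne_zero _ hx.ne'
  field_simp

/-- `log μ_k + log μ_{k+1} − 2 log|e_k| = (d_k + d_{k+1} − 2f_k)·log x`. [this file] -/
theorem log_ratio (x : ℝ) (hx : 0 < x) (k : ℕ) (hk : (pathDet (fun _ => (1 : ℝ)) d (fun _ => (1 : ℝ)) f k).eval x ≠ 0)
    (hk1 : (pathDet (fun _ => (1 : ℝ)) d (fun _ => (1 : ℝ)) f (k + 1)).eval x ≠ 0) :
    log (x ^ d k * (pathDet (fun _ => (1 : ℝ)) d (fun _ => (1 : ℝ)) f k).eval x ^ 2 / x ^ (2 * ∑ j ∈ range k, f j)) +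
        log (x ^ d (k + 1) * (pathDet (fun _ => (1 : ℝ)) d (fun _ => (1 : ℝ)) f (k + 1)).eval x ^ 2 / x ^ (2 * ∑ j ∈ range (k + 1), f j)) -
        2 * log ((pathDet (fun _ => (1 : ℝ)) d (fun _ => (1 : ℝ)) f k).eval x *
          (pathDet (fun _ => (1 : ℝ)) d (fun _ => (1 : ℝ)) f (k + 1)).eval x / x ^ (2 * ∑ j ∈ range k, f j)) =
      (((d k + d (k + 1) : ℕ) : ℝ) - 2 * (f k : ℝ)) * log x := by
  have hμ : 0 < x ^ d k * (pathDet (fun _ => (1 : ℝ)) d (fun _ => (1 : ℝ)) f k).eval x ^ 2 / x ^ (2 * ∑ j ∈ range k, f j) := by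
    positivity
  have hμ1 : 0 < x ^ d (k + 1) * (pathDet (fun _ => (1 : ℝ)) d (fun _ => (1 : ℝ)) f (k + 1)).eval x ^ 2 /
      x ^ (2 * ∑ j ∈ range (k + 1), f j) := by positivity
  have he : (pathDet (fun _ => (1 : ℝ)) d (fun _ => (1 : ℝ)) f k).eval x *
      (pathDet (fun _ => (1 : ℝ)) d (fun _ => (1 : ℝ)) f (k + 1)).eval x / x ^ (2 * ∑ j ∈ range k, f j) ≠ 0 := by
    refine div_ne_zero (mul_ne_zero hk hk1) (pow_ne_zero _ hx.ne')
  have h2 : (2 : ℝ) * log ((pathDet (fun _ => (1 : ℝ)) d (fun _ => (1 : ℝ)) f k).eval x *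
      (pathDet (fun _ => (1 : ℝ)) d (fun _ => (1 : ℝ)) f (k + 1)).eval x / x ^ (2 * ∑ j ∈ range k, f j)) =
      log (((pathDet (fun _ => (1 : ℝ)) d (fun _ => (1 : ℝ)) f k).eval x *
      (pathDet (fun _ => (1 : ℝ)) d (fun _ => (1 : ℝ)) f (k + 1)).eval x / x ^ (2 * ∑ j ∈ range k, f j)) ^ 2) := by
    rw [log_pow]; norm_num
  rw [h2, ← log_mul hμ.ne' hμ1.ne', ← log_div (mul_pos hμ hμ1).ne' (pow_ne_zero 2 he), ratio_eq d f x hx k hk hk1,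
    log_div (pow_ne_zero _ hx.ne') (pow_ne_zero _ hx.ne'), log_pow, log_pow]
  push_cast
  ring

/-- **flank lemma**: a recessive edge (`a² < (y + a)(a + t)`, the product of the two adjacent masses) next to a negative energy `t < 0`
(mass `a + t > 0`) forces the second neighbour's energy above `−t`: `−t < y`. [this file] -/
theorem flank_aux {a t y : ℝ} (hat : 0 < a + t) (h : a ^ 2 < (y + a) * (a + t)) : -t < y := by
  rcases lt_or_ge (-t) y with hlt | hcon
  · exact hlt
  · nlinarith [mul_le_mul_of_nonneg_right hcon hat.le, sq_nonneg t]

/-! ### 2. The crossing-direction law -/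

/-- **CROSSING-DIRECTION LAW (all sizes).**  Let `x > 0` be a zero of `D_m` (`m ≥ 3`) with `D_1, …, D_{m−1}` nonzero at `x`, every edge RECESSIVE
at `x` (`x^{2f_k} < x^{d_k + d_{k+1}}`), and no two negative pivot products exactly three edges apart (`D_kD_{k+1} < 0 ⇒ D_{k+3}D_{k+4} > 0`).
Then the entrywise-log-derivative balance is positive: `0 < Σ_{k<m−1} (d_k + d_{k+1} − 2f_k)·log x·(D_kD_{k+1}/x^{2F_k})`. [this file] -/
theorem slopeEnergy_balance_pos (m : ℕ) (hm : 3 ≤ m) (x : ℝ) (hx : 0 < x)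
    (hrec : ∀ k, k + 1 < m → x ^ (2 * f k) < x ^ (d k + d (k + 1)))
    (hroot : (pathDet (fun _ => (1 : ℝ)) d (fun _ => (1 : ℝ)) f m).eval x = 0)
    (hnd : ∀ k, 0 < k → k < m → (pathDet (fun _ => (1 : ℝ)) d (fun _ => (1 : ℝ)) f k).eval x ≠ 0)
    (hsep : ∀ k, k + 4 < m →
      (pathDet (fun _ => (1 : ℝ)) d (fun _ => (1 : ℝ)) f k).eval x * (pathDet (fun _ => (1 : ℝ)) d (fun _ => (1 : ℝ)) f (k + 1)).eval x < 0 →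
      0 < (pathDet (fun _ => (1 : ℝ)) d (fun _ => (1 : ℝ)) f (k + 3)).eval x * (pathDet (fun _ => (1 : ℝ)) d (fun _ => (1 : ℝ)) f (k + 4)).eval x) :
    0 < ∑ k ∈ range (m - 1), (((d k + d (k + 1) : ℕ) : ℝ) - 2 * (f k : ℝ)) * log x *
      ((pathDet (fun _ => (1 : ℝ)) d (fun _ => (1 : ℝ)) f k).eval x * (pathDet (fun _ => (1 : ℝ)) d (fun _ => (1 : ℝ)) f (k + 1)).eval x /
        x ^ (2 * ∑ j ∈ range k, f j)) := by
  obtain ⟨n, rfl⟩ : ∃ n, m = n + 2 := ⟨m - 2, by omega⟩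
  have hn : 1 ≤ n := by omega
  rw [show n + 2 - 1 = n + 1 by omega]
  -- energies `e` and masses `μ` (opaque names with defining equations)
  obtain ⟨e, he⟩ : ∃ e : ℕ → ℝ, ∀ k, e k = (pathDet (fun _ => (1 : ℝ)) d (fun _ => (1 : ℝ)) f k).eval x *
      (pathDet (fun _ => (1 : ℝ)) d (fun _ => (1 : ℝ)) f (k + 1)).eval x / x ^ (2 * ∑ j ∈ range k, f j) := ⟨_, fun _ => rfl⟩
  obtain ⟨μ, hμ⟩ : ∃ μ : ℕ → ℝ, ∀ i, μ i = x ^ d i * (pathDet (fun _ => (1 : ℝ)) d (fun _ => (1 : ℝ)) f i).eval x ^ 2 /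
      x ^ (2 * ∑ j ∈ range i, f j) := ⟨_, fun _ => rfl⟩
  have hD0 : (pathDet (fun _ => (1 : ℝ)) d (fun _ => (1 : ℝ)) f 0).eval x = 1 := (eval_unit_zero_one d f x).1
  have hDne : ∀ k, k ≤ n + 1 → (pathDet (fun _ => (1 : ℝ)) d (fun _ => (1 : ℝ)) f k).eval x ≠ 0 := by
    intro k hk
    rcases Nat.eq_zero_or_pos k with rfl | hk0
    · rw [hD0]; exact one_ne_zero
    · exact hnd k hk0 (by omega)
  have hμe : ∀ i, μ (i + 1) = e i + e (i + 1) := by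
    intro i; rw [hμ, he, he]; exact (energy_succ_add d f x hx i).symm
  have hμ0 : μ 0 = e 0 := by rw [hμ, he]; exact energy_zero d f x
  have heN : e (n + 1) = 0 := by
    rw [he, show n + 1 + 1 = n + 2 by omega, hroot, mul_zero, zero_div]
  have hμn : μ (n + 1) = e n := by rw [hμe, heN, add_zero]
  have hμpos : ∀ i, i ≤ n + 1 → 0 < μ i := by
    intro i hi
    have := hDne i hi
    rw [hμ]
    positivity
  have hene : ∀ k, k ≤ n → e k ≠ 0 := by
    intro k hk
    rw [he]
    exact div_ne_zero (mul_ne_zero (hDne k (by omega)) (hDne (k + 1) (by omega))) (pow_ne_zero _ hx.ne')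
  have hend : 0 < e n := by rw [← hμn]; exact hμpos (n + 1) le_rfl
  -- recessive edges: `e_j² < μ_j μ_{j+1}`
  have hW : ∀ j, j ≤ n → e j ^ 2 < μ j * μ (j + 1) := by
    intro j hj
    have hq := ratio_eq d f x hx j (hDne j (by omega)) (hDne (j + 1) (by omega))
    have he2 : 0 < e j ^ 2 := by have := hene j hj; positivity
    rw [← one_lt_div he2, he, hμ, hμ, hq, one_lt_div (pow_pos hx _)]
    exact hrec j (by omega)
  -- the target sum is the edge sum
  have hterm : ∀ k ∈ range (n + 1), (((d k + d (k + 1) : ℕ) : ℝ) - 2 * (f k : ℝ)) * log x *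
      ((pathDet (fun _ => (1 : ℝ)) d (fun _ => (1 : ℝ)) f k).eval x * (pathDet (fun _ => (1 : ℝ)) d (fun _ => (1 : ℝ)) f (k + 1)).eval x /
        x ^ (2 * ∑ j ∈ range k, f j)) =
      e k * (log (μ k) + log (μ (k + 1)) - 2 * log (e k)) := by
    intro k hk
    rw [mem_range] at hk
    rw [hμ, hμ, he, log_ratio d f x hx k (hDne k (by omega)) (hDne (k + 1) (by omega))]
    ring
  rw [sum_congr rfl hterm, edge_sum_eq_vertex_sum n e μ hμ0 (fun i hi _ => by
    obtain ⟨i', rfl⟩ : ∃ i', i = i' + 1 := ⟨i - 1, by omega⟩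
    rw [Nat.add_sub_cancel]; exact hμe i') hμn]
  -- hypotheses of the entropy balance inequality
  refine entropyBalance_pos n e hn hend (fun j _ => by rw [← hμe]; exact hμpos (j + 1) (by omega)) hene ?_ ?_
  · intro k hk hneg
    have he0 : 0 < e 0 := by rw [← hμ0]; exact hμpos 0 (by omega)
    have hk0 : k ≠ 0 := by rintro rfl; linarith
    -- `k ≠ 1`: the recessive edge `0`
    have hk1 : k ≠ 1 := by
      rintro rfl
      have h := hW 0 (by omega)
      rw [hμ0, hμe 0, zero_add] at h
      nlinarith
    -- `k ≤ n - 2`: the recessive edge `n`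
    have hkn : k ≠ n := by rintro rfl; linarith
    have hkn1 : k + 1 ≠ n := by
      intro hk'
      subst hk'
      have h := hW (k + 1) le_rfl
      rw [hμn, hμe k] at h
      nlinarith
    have hk2 : 2 ≤ k := by omega
    have hk2n : k + 2 ≤ n := by omega
    refine ⟨hk2, hk2n, ?_, ?_⟩
    · -- left flank from the recessive edge `k - 1`
      obtain ⟨k', rfl⟩ : ∃ k', k = k' + 2 := ⟨k - 2, by omega⟩
      have h := hW (k' + 1) (by omega)
      rw [hμe k', hμe (k' + 1)] at h
      rw [show k' + 2 - 2 = k' by omega]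
      have hat : 0 < e (k' + 1) + e (k' + 1 + 1) := by rw [← hμe (k' + 1)]; exact hμpos _ (by omega)
      exact flank_aux hat h
    · -- right flank from the recessive edge `k + 1`
      have h := hW (k + 1) (by omega)
      rw [hμe k, hμe (k + 1)] at h
      have hat : 0 < e (k + 1) + e k := by rw [add_comm, ← hμe k]; exact hμpos _ (by omega)
      exact flank_aux (y := e (k + 1 + 1)) hat (h.trans_eq (by ring))
  · intro k hk hneg
    rw [he] at hneg
    have hDD : (pathDet (fun _ => (1 : ℝ)) d (fun _ => (1 : ℝ)) f k).eval x *
        (pathDet (fun _ => (1 : ℝ)) d (fun _ => (1 : ℝ)) f (k + 1)).eval x < 0 := by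
      rcases lt_or_ge ((pathDet (fun _ => (1 : ℝ)) d (fun _ => (1 : ℝ)) f k).eval x *
        (pathDet (fun _ => (1 : ℝ)) d (fun _ => (1 : ℝ)) f (k + 1)).eval x) 0 with hlt | hge
      · exact hlt
      · exact absurd hneg (not_lt.2 (div_nonneg hge (pow_pos hx _).le))
    have h3 := hsep k (by omega) hDD
    rw [he, show k + 3 + 1 = k + 4 by omega]
    exact div_pos h3 (pow_pos hx _)

/-! ### 3. The two recessive sides of a one-signed design -/

/-- **below the resonance**: `0 < x < 1`, all slopes positive (`d_k + d_{k+1} < 2f_k`), separation as above ⇒ the SLOPE-WEIGHTED ENERGY is positive,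
`0 < Σ_k (2f_k − d_k − d_{k+1}) · D_kD_{k+1} x^{−2F_k}` — the zero eigenvalue moves down: one more negative eigenvalue after `x`. [this file] -/
theorem slopeEnergy_pos_below_one (m : ℕ) (hm : 3 ≤ m) (x : ℝ) (hx : 0 < x) (hx1 : x < 1)
    (hslope : ∀ k, k + 1 < m → d k + d (k + 1) < 2 * f k)
    (hroot : (pathDet (fun _ => (1 : ℝ)) d (fun _ => (1 : ℝ)) f m).eval x = 0)
    (hnd : ∀ k, 0 < k → k < m → (pathDet (fun _ => (1 : ℝ)) d (fun _ => (1 : ℝ)) f k).eval x ≠ 0)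
    (hsep : ∀ k, k + 4 < m →
      (pathDet (fun _ => (1 : ℝ)) d (fun _ => (1 : ℝ)) f k).eval x * (pathDet (fun _ => (1 : ℝ)) d (fun _ => (1 : ℝ)) f (k + 1)).eval x < 0 →
      0 < (pathDet (fun _ => (1 : ℝ)) d (fun _ => (1 : ℝ)) f (k + 3)).eval x * (pathDet (fun _ => (1 : ℝ)) d (fun _ => (1 : ℝ)) f (k + 4)).eval x) :
    0 < ∑ k ∈ range (m - 1), ((2 * (f k : ℝ)) - ((d k + d (k + 1) : ℕ) : ℝ)) *
      ((pathDet (fun _ => (1 : ℝ)) d (fun _ => (1 : ℝ)) f k).eval x * (pathDet (fun _ => (1 : ℝ)) d (fun _ => (1 : ℝ)) f (k + 1)).eval x /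
        x ^ (2 * ∑ j ∈ range k, f j)) := by
  have hlog : log x < 0 := log_neg hx hx1
  have h := slopeEnergy_balance_pos d f m hm x hx (fun k hk => pow_lt_pow_right_of_lt_one₀ hx hx1 (hslope k hk)) hroot hnd hsep
  have hrw : ∑ k ∈ range (m - 1), (((d k + d (k + 1) : ℕ) : ℝ) - 2 * (f k : ℝ)) * log x *
      ((pathDet (fun _ => (1 : ℝ)) d (fun _ => (1 : ℝ)) f k).eval x * (pathDet (fun _ => (1 : ℝ)) d (fun _ => (1 : ℝ)) f (k + 1)).eval x /
        x ^ (2 * ∑ j ∈ range k, f j)) =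
      (-log x) * ∑ k ∈ range (m - 1), ((2 * (f k : ℝ)) - ((d k + d (k + 1) : ℕ) : ℝ)) *
      ((pathDet (fun _ => (1 : ℝ)) d (fun _ => (1 : ℝ)) f k).eval x * (pathDet (fun _ => (1 : ℝ)) d (fun _ => (1 : ℝ)) f (k + 1)).eval x /
        x ^ (2 * ∑ j ∈ range k, f j)) := by
    rw [mul_sum]; exact sum_congr rfl fun k _ => by ring
  rw [hrw] at h
  exact (pos_iff_pos_of_mul_pos h).1 (by linarith)

/-- **above the resonance**: `x > 1`, all slopes negative (`2f_k < d_k + d_{k+1}`), separation as above ⇒ `Σ_k (2f_k − d_k − d_{k+1}) · D_kD_{k+1} x^{−2F_k} < 0`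
(equivalently `Σ_k |L_k|·e_k > 0`): again one more negative eigenvalue after `x`. [this file] -/
theorem slopeEnergy_neg_above_one (m : ℕ) (hm : 3 ≤ m) (x : ℝ) (hx1 : 1 < x)
    (hslope : ∀ k, k + 1 < m → 2 * f k < d k + d (k + 1))
    (hroot : (pathDet (fun _ => (1 : ℝ)) d (fun _ => (1 : ℝ)) f m).eval x = 0)
    (hnd : ∀ k, 0 < k → k < m → (pathDet (fun _ => (1 : ℝ)) d (fun _ => (1 : ℝ)) f k).eval x ≠ 0)
    (hsep : ∀ k, k + 4 < m →
      (pathDet (fun _ => (1 : ℝ)) d (fun _ => (1 : ℝ)) f k).eval x * (pathDet (fun _ => (1 : ℝ)) d (fun _ => (1 : ℝ)) f (k + 1)).eval x < 0 →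
      0 < (pathDet (fun _ => (1 : ℝ)) d (fun _ => (1 : ℝ)) f (k + 3)).eval x * (pathDet (fun _ => (1 : ℝ)) d (fun _ => (1 : ℝ)) f (k + 4)).eval x) :
    ∑ k ∈ range (m - 1), ((2 * (f k : ℝ)) - ((d k + d (k + 1) : ℕ) : ℝ)) *
      ((pathDet (fun _ => (1 : ℝ)) d (fun _ => (1 : ℝ)) f k).eval x * (pathDet (fun _ => (1 : ℝ)) d (fun _ => (1 : ℝ)) f (k + 1)).eval x /
        x ^ (2 * ∑ j ∈ range k, f j)) < 0 := by
  have hx : 0 < x := one_pos.trans hx1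
  have hlog : 0 < log x := log_pos hx1
  have h := slopeEnergy_balance_pos d f m hm x hx (fun k hk => pow_lt_pow_right₀ hx1 (hslope k hk)) hroot hnd hsep
  have hrw : ∑ k ∈ range (m - 1), (((d k + d (k + 1) : ℕ) : ℝ) - 2 * (f k : ℝ)) * log x *
      ((pathDet (fun _ => (1 : ℝ)) d (fun _ => (1 : ℝ)) f k).eval x * (pathDet (fun _ => (1 : ℝ)) d (fun _ => (1 : ℝ)) f (k + 1)).eval x /
        x ^ (2 * ∑ j ∈ range k, f j)) =
      (-log x) * ∑ k ∈ range (m - 1), ((2 * (f k : ℝ)) - ((d k + d (k + 1) : ℕ) : ℝ)) *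
      ((pathDet (fun _ => (1 : ℝ)) d (fun _ => (1 : ℝ)) f k).eval x * (pathDet (fun _ => (1 : ℝ)) d (fun _ => (1 : ℝ)) f (k + 1)).eval x /
        x ^ (2 * ∑ j ∈ range k, f j)) := by
    rw [mul_sum]; exact sum_congr rfl fun k _ => by ring
  rw [hrw] at h
  have : 0 < log x * -(∑ k ∈ range (m - 1), ((2 * (f k : ℝ)) - ((d k + d (k + 1) : ℕ) : ℝ)) *
      ((pathDet (fun _ => (1 : ℝ)) d (fun _ => (1 : ℝ)) f k).eval x * (pathDet (fun _ => (1 : ℝ)) d (fun _ => (1 : ℝ)) f (k + 1)).eval x /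
        x ^ (2 * ∑ j ∈ range k, f j))) := by linarith
  have := (pos_iff_pos_of_mul_pos this).1 hlog
  linarith

/-- **LOW CLASSES (all sizes)**: below the resonance, all slopes positive, and AT MOST ONE negative pivot product among `D_kD_{k+1}`
(`k < m − 1`; i.e. the leading principal minors change sign at most once — the matrix has at most one negative eigenvalue at the zero `x`):
the slope-weighted energy is positive, unconditionally. [this file] -/
theorem slopeEnergy_pos_below_one_of_atMostOne (m : ℕ) (hm : 3 ≤ m) (x : ℝ) (hx : 0 < x) (hx1 : x < 1)
    (hslope : ∀ k, k + 1 < m → d k + d (k + 1) < 2 * f k)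
    (hroot : (pathDet (fun _ => (1 : ℝ)) d (fun _ => (1 : ℝ)) f m).eval x = 0)
    (hnd : ∀ k, 0 < k → k < m → (pathDet (fun _ => (1 : ℝ)) d (fun _ => (1 : ℝ)) f k).eval x ≠ 0)
    (hone : ∀ k k', k < k' → k' + 1 < m →
      (pathDet (fun _ => (1 : ℝ)) d (fun _ => (1 : ℝ)) f k).eval x * (pathDet (fun _ => (1 : ℝ)) d (fun _ => (1 : ℝ)) f (k + 1)).eval x < 0 →
      0 ≤ (pathDet (fun _ => (1 : ℝ)) d (fun _ => (1 : ℝ)) f k').eval x * (pathDet (fun _ => (1 : ℝ)) d (fun _ => (1 : ℝ)) f (k' + 1)).eval x) :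
    0 < ∑ k ∈ range (m - 1), ((2 * (f k : ℝ)) - ((d k + d (k + 1) : ℕ) : ℝ)) *
      ((pathDet (fun _ => (1 : ℝ)) d (fun _ => (1 : ℝ)) f k).eval x * (pathDet (fun _ => (1 : ℝ)) d (fun _ => (1 : ℝ)) f (k + 1)).eval x /
        x ^ (2 * ∑ j ∈ range k, f j)) := by
  refine slopeEnergy_pos_below_one d f m hm x hx hx1 hslope hroot hnd fun k hk hneg => ?_
  have h0 := hone k (k + 3) (by omega) (by omega) hneg
  rw [show k + 3 + 1 = k + 4 by omega] at h0
  refine lt_of_le_of_ne h0 (fun h => ?_)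
  rcases mul_eq_zero.1 h.symm with h3 | h4
  · exact hnd (k + 3) (by omega) (by omega) h3
  · exact hnd (k + 4) (by omega) (by omega) h4

end StaticTridiagonalRealUnit
end Summit.ValiantsHypothesis.ValiantsHypothesis.Theorems.KPlusLogSqLaw
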